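import Literature.MathematicalPhysics.QuantumFieldTheory.Balaban1983to89.B11Eq44COperatorTower

/-!
# `Balaban1983to89.B9Eq315QTowerRegularityProfile` — T. Bałaban, *Averaging operations for lattice gauge theories*, Commun. Math. Phys. **98** (1985)
# 17–51 [Balaban1985Averaging] Proposition 2 (52)–(54) p. 26 READ PER LEVEL ON THE TOWER OF `B9Eq315QTower`: **THE BLOCK-LOOP REGULARITY PROFILE
# OF THE COMPOSED LEVEL AVERAGES `Ū^j` IS GEOMETRIC IN THE DEPTH** — `α_n ≤ 32(d+1)(d+4)α₀·(L^{−2})^n` at the depth `n` (the factor `Q(Ū^{k−1−n})` of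
# [Balaban1985BackgroundPropagators] (3.15)), from (52) `sup_p|U(∂p) − 1| < α₀η²`; the `α`-profile hypothesis of `B9Eq315QTowerLipschitzProfile` §4 DERIVED

statement-level skeleton of published theorems with citation tags; proofs where landed; nothing here is a claim about the Yang–Mills mass gap

PDF held: `paper:balaban1985-cmp98-averaging` pp. 25–26, 37 through the tree's `B7Prop2Explicit` ∕ `B7Eq123General` ∕ `B11Eq44COperatorTower` docstrings
(verbatim there).
THE PRINT (verbatim, p. 26).  *«Proposition 2. … If U satisfies (52) … then |Ū^k(∂p) − 1| < α₀ + 2C₀α₀² < 2α₀»*; (53): the bound at every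
intermediate level `j`, *«α₀(L^jη)² + C₀(α₀(L^jη)²)²[…]»*; p. 37 (after (127)): the averaged configurations `Ū₀^j` are regular *«with 2α₀L^{2j}η²»*;
p. 25 (before (47)): block loops are within *«O(1)L²·»* the plaquette deviation of `1`.

WHY THIS FILE (cell context).  `B9Eq315QTowerLipschitzProfile` §4 (this lineage, gen 84) bounds the tower averaging letters INDEPENDENTLY of the number
of levels GIVEN geometric level profiles `α_n ≤ α⋆r^n` (block-loop regularity) and `ε_n ≤ ε⋆r^n` (bond smallness) of the composed averages — print's
running conditions, displayed.  The NE7c ∕ lit-balaban crews' kernel theorems `B7Eq123General.level_data` («|Ū^j(∂p) − 1| < 2α₀(L^j∕L^k)²», = (53)∕p. 37)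
and `blockLoops_of_pdev` (p. 25's «O(1)L²·») DERIVE the first profile from the single fine-lattice condition (52): `16(d+1)(d+4)L²·2α₀(L^j∕L^k)² =
32(d+1)(d+4)α₀·L^{−2n}` at `j = k − 1 − n`.  ne9-leaf-03's `B11Eq44COperatorTower.ulev_reg_of_pdev` is the depth-UNIFORM rounding (`(L^j∕L^k)² ≤ 1`,
`αT = 32(d+1)(d+4)L²α₀`) of the same inequality; this file keeps the geometric factor.

WHAT IS PROVED (sorry-free; 0 `def`; nothing of the papers asserted — (52)–(54) enter as the crews' tree THEOREMS).
* **`ulev_reg_geometric`**: under (52) with print's thresholds (`C₀α₀ ≤ 1∕3`, `4α₀ ≤ c₂′(d,L)`, `U` valued in an averaging-closed `G ⊂ U1`, `L ≥ 2`), for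
  every composed depth `n < k`: `‖Ū^{k−1−n}(block loop) − 1‖ ≤ 32(d+1)(d+4)α₀·((L²)⁻¹)^n`.
* **`exists_reg_profile_geometric`**: the profile letters of `B9Eq315QTowerLipschitzProfile` §4 packaged — `α⋆ = 32(d+1)(d+4)α₀ ≥ 0`, `r = L^{−2} ∈ [0,1)`,
  and the bound at every `n < k`.
MODEL ∕ DECLARED READINGS.  (M1) as `B11Eq44COperatorTower` §2 (tower of `B9Eq315QTower`, periodic readings, (52) on the periodic extension of the finest
background).  (M2) NOT HERE — the BOND-smallness profile `ε_n` of `B9Eq315QTowerLipschitzProfile`: bond variables are not functions of the plaquette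
variables (gauge freedom); print obtains small bonds in per-block axial gauges ((3.37), Lemma 3.1) — ne9-leaf-03's `B7Eq44TorusAxialGauge[Local]` ∕ Tier P
direction; it stays displayed there.  (M3) junk depths `n ≥ k` (never composed into `Q_k`) are excluded (`n < k`), as the profile hypotheses of §4 there are.
HONEST SCOPE.  [folklore] exponent bookkeeping on two crews' theorems; «NE9 ⇐ the named binders»; NE9 NOT PRINTED ∕ NOT PROVED; NOT summit progress (cell
pub-balaban: row NE9 WALLED ON A MODEL; spine PROVED 0∕9; rung (B)+1 finite T⁴ — NOT infinite volume, NOT mass gap, NOT Clay; HONEST DEPENDENCY: continuum YM on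
T⁴ ⇐ BetaPertH ∧ nine spine estimates (0/9 proved); BetaPertH ⇐ (D1) ∧ (D4) ∧ CAP+tail; G-an2-4 gates asym, D1 and NE2/3/4).  Filed by the pub-balaban NE9
BINDER-row owner lineage `b2b-balaban-t4-ne9-p1` (gen 84), INTENT I-ne9p1-g84-6; NEW file importing `B11Eq44COperatorTower` only; modifies nothing.
Net new unproved facts: 0.
-/

noncomputable section

namespace Literature.MathematicalPhysics.QuantumFieldTheory.Balaban1983to89.B9Eq315QTowerRegularityProfile

open B9Eq315QTorus (perSite perCfg perCfg_apply cornerSite)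
open B9Eq315QTower (towerP towerP_apply UlevOf perCfg_UlevOf)
open B9SectCLatticeCarrier (Bond)
open B4Sect5Torus (TSite)
open B7Prop1Explicit (U1 Wcx boxVec)
open B7Prop2Explicit (pdev AvgClosed C0 c2' avgIter avgIter_zero)
open B7Eq123General (blockLoops_of_pdev level_data)

variable {d : ℕ} {𝔸 : Type*} [NormedRing 𝔸] [NormedAlgebra ℂ 𝔸] [CompleteSpace 𝔸] [NormOneClass 𝔸] (L : ℕ) [NeZero L] (m : Fin d → ℕ)
  [∀ i, NeZero (m i)] (k : ℕ) (U : Bond d (towerP L m k) → 𝔸ˣ)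
  (hL : 2 ≤ L) {G : Subgroup 𝔸ˣ} (hG : AvgClosed d L G)
  (hU : ∀ (x : B7Prop1Explicit.Site d) (κ : Fin d), perCfg (towerP L m k) U x κ ∈ G) {α₀ : ℝ} (hα : 0 < α₀)
  (hα3 : C0 d * α₀ ≤ 1 / 3) (hα4 : 4 * α₀ ≤ c2' d L) (h52 : pdev (perCfg (towerP L m k) U) < α₀ * (((L : ℝ) ^ k)⁻¹) ^ 2)

include hL hG hU hα hα3 hα4 h52 in
/-- **THE BLOCK-LOOP REGULARITY PROFILE OF THE COMPOSED LEVEL AVERAGES IS GEOMETRIC IN THE DEPTH** — [Balaban1985Averaging] Prop. 2 per level, in the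
depth index of `B9Eq315QTower.Qtower`: under (52) `sup_p |U(∂p) − 1| < α₀η²` (`η = L^{−k}`, `U` valued in an averaging-closed group `G`, print's thresholds
on `α₀`), the level background composed at depth `n < k` — `Ū^j`, `j = k − 1 − n` — has block loops within `32(d+1)(d+4)α₀·(L^{−2})^n` of `1`:
`α_n ≤ α⋆·r^n` with `α⋆ = 32(d+1)(d+4)α₀`, `r = L^{−2}`.  (The crews' `B7Eq123General.level_data` — «|Ū^j(∂p) − 1| < 2α₀(L^j∕L^k)²» — and
`blockLoops_of_pdev` — «O(1)L²·» that —, with `L²·(L^j∕L^k)² = L^{−2n}`; ne9-leaf-03's `B11Eq44COperatorTower.ulev_reg_of_pdev` is the depth-UNIFORM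
rounding `αT = 32(d+1)(d+4)L²α₀` of the same.)  This is the `α`-profile hypothesis of `B9Eq315QTowerLipschitzProfile` §4 DERIVED from (52); the
bond-smallness profile `ε_n` is NOT derivable gauge-free (bond variables are not functions of plaquettes) and stays displayed there.
[cite: Balaban1985Averaging, Prop. 2 (52)–(54) p.26, p.25 (displays before (47)), p.37 (after (127)); Balaban1985BackgroundPropagators, (3.35)–(3.37) p.396] -/
theorem ulev_reg_geometric {n : ℕ} (hn : n < k) (y : TSite d (towerP L m n)) (κ : Fin d) (r : Fin d → Fin L) :
    ‖((Wcx L (perCfg (towerP L m (n + 1)) (UlevOf L m k U n)) (cornerSite L y) κ (boxVec L r) : 𝔸ˣ) : 𝔸) - 1‖ ≤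
      (32 * ((d : ℝ) + 1) * ((d : ℝ) + 4) * α₀) * (((L : ℝ) ^ 2)⁻¹) ^ n := by
  have hL1 : 1 ≤ L := le_trans (by norm_num) hL
  have hL0 : (0 : ℝ) < L := by exact_mod_cast hL1
  have hnk : n + 1 ≤ k := hn
  -- the depth-`n` background IS `Ū^{k-1-n}`
  have hper : perCfg (towerP L m (n + 1)) (UlevOf L m k U n) = avgIter L (perCfg (towerP L m k) U) (k - 1 - n) := perCfg_UlevOf L m hnk U
  obtain ⟨hV1, hβ0, hβ, hβmax⟩ := level_data L hL hG k _ hU hα hα3 hα4 h52 (k - 1 - n) (by omega)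
  rw [hper]
  refine ((blockLoops_of_pdev hL1 hV1 hβ0 hβ hβmax (cornerSite L y) κ).1 r).trans (le_of_eq ?_)
  -- `16(d+1)(d+4)L²·2α₀(L^{k-1-n}/L^k)² = 32(d+1)(d+4)α₀·L^{-2n}`
  have hpow : (L : ℝ) ^ 2 * ((L : ℝ) ^ (k - 1 - n) * ((L : ℝ) ^ k)⁻¹) ^ 2 = (((L : ℝ) ^ 2)⁻¹) ^ n := by
    have hk : k = (k - 1 - n) + n + 1 := by omega
    have hLk : (L : ℝ) ^ k = (L : ℝ) ^ (k - 1 - n) * (L : ℝ) ^ n * L := by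
      conv_lhs => rw [hk, pow_add, pow_add, pow_one]
    rw [hLk, inv_pow, ← pow_mul]
    have hne : (L : ℝ) ^ (k - 1 - n) ≠ 0 := pow_ne_zero _ hL0.ne'
    have hne' : (L : ℝ) ^ n ≠ 0 := pow_ne_zero _ hL0.ne'
    have hne2 : (L : ℝ) ^ (2 * n) ≠ 0 := pow_ne_zero _ hL0.ne'
    field_simp
    ring
  calc 16 * ((d : ℝ) + 1) * ((d : ℝ) + 4) * (L : ℝ) ^ 2 * (2 * (α₀ * ((L : ℝ) ^ (k - 1 - n) * ((L : ℝ) ^ k)⁻¹) ^ 2))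
      = (32 * ((d : ℝ) + 1) * ((d : ℝ) + 4) * α₀) * ((L : ℝ) ^ 2 * ((L : ℝ) ^ (k - 1 - n) * ((L : ℝ) ^ k)⁻¹) ^ 2) := by ring
    _ = (32 * ((d : ℝ) + 1) * ((d : ℝ) + 4) * α₀) * (((L : ℝ) ^ 2)⁻¹) ^ n := by rw [hpow]

include hL hG hU hα hα3 hα4 h52 in
/-- **… and the ratio is `< 1`, the profile admissible for `B9Eq315QTowerLipschitzProfile` §4**: `0 ≤ L^{−2} < 1` (`L ≥ 2`), `0 ≤ α⋆`, and the
geometric bound at every composed depth `n < k`. [cite: Balaban1985Averaging, Prop. 2 (52)–(54) p.26; Balaban1985BackgroundPropagators, (3.35)–(3.37) p.396] -/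
theorem exists_reg_profile_geometric :
    ∃ αs r : ℝ, αs = 32 * ((d : ℝ) + 1) * ((d : ℝ) + 4) * α₀ ∧ r = ((L : ℝ) ^ 2)⁻¹ ∧ 0 ≤ αs ∧ 0 ≤ r ∧ r < 1 ∧
      ∀ n < k, ∀ (y : TSite d (towerP L m n)) (κ : Fin d) (rr : Fin d → Fin L),
        ‖((Wcx L (perCfg (towerP L m (n + 1)) (UlevOf L m k U n)) (cornerSite L y) κ (boxVec L rr) : 𝔸ˣ) : 𝔸) - 1‖ ≤ αs * r ^ n := by
  have hL2 : (2 : ℝ) ≤ L := by exact_mod_cast hL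
  refine ⟨_, _, rfl, rfl, by positivity, by positivity, ?_, fun n hn y κ rr => ulev_reg_geometric L m k U hL hG hU hα hα3 hα4 h52 hn y κ rr⟩
  have h4 : (4 : ℝ) ≤ (L : ℝ) ^ 2 := by nlinarith
  exact inv_lt_one_of_one_lt₀ (by linarith)

end Literature.MathematicalPhysics.QuantumFieldTheory.Balaban1983to89.B9Eq315QTowerRegularityProfile

end
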